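import Literature.AnabelianGeometry.SemiGraphs.SubdivisionLemmas
import HarnessLib

/-!
# Isomorphisms of semi-graphs: a bijectivity criterion and transport of trees ([SemiAnbd] §1 pp. 11–13)

Mochizuki, *Semi-graphs of anabelioids*, Publ. RIMS **42** (2006), §1, author's manuscript pp. 11–13
[cite: MochizukiSemiAnbd2006, §1 pp.11-13]: morphisms of semi-graphs (p. 11) and the topological
notions "connected" / "tree" (pp. 11–13), rendered in `SemiGraph.lean` through the barycentric
subdivision.  Generic tools (no new notions):

* `SemiGraph.Hom.isoOfBijective` — a morphism of semi-graphs bijective on vertices, on edges and on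
  branches, and sending branches abutting to no vertex to branches abutting to no vertex, is an
  isomorphism (its inverse maps form a morphism);
* `SemiGraph.Hom.nodeMap`, `SemiGraph.subdivisionIso` — the node map of a morphism (as in
  `SemiGraph.nodeMap` for automorphisms, `FreeGroupsAndActions.lean`); an isomorphism of semi-graphs
  induces an isomorphism of barycentric subdivisions;
* `SemiGraph.IsTree.of_iso` — trees transport along isomorphisms (connectedness:
  `SemiGraph.isConnected_of_isIso`, `CoverticialVertexCaseTools.lean`).

Used by `UniversalCoveringOverOrbitGraph.lean` (the underlying semi-graph of `𝒢_{∞,S}` is the tree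
`𝔾̃_S`, [SemiAnbd] p. 38). Seat abc-iut-L3-t6. Nothing here bears on [IUTchIII] Cor. 3.12.
-/

namespace Literature.AnabelianGeometry.SemiGraphs

open CategoryTheory

universe u

/-! ### Generic: isomorphisms of semi-graphs -/

namespace SemiGraph

variable {G G' : SemiGraph.{u}}

/-- A morphism of semi-graphs which is bijective on vertices, on edges and on branches, and maps
branches abutting to no vertex to branches abutting to no vertex, is an isomorphism (the inverse maps
are then again a morphism of semi-graphs, [SemiAnbd] §1 p. 11). [cite: MochizukiSemiAnbd2006, §1 p.11] -/
noncomputable def Hom.isoOfBijective (φ : G ⟶ G') (hv : Function.Bijective φ.vertexMap)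
    (he : Function.Bijective φ.edgeMap) (hb : Function.Bijective φ.branchMap)
    (hn : ∀ b : G.Branch, G.abuts b = none → G'.abuts (φ.branchMap b) = none) : G ≅ G' where
  hom := φ
  inv :=
    { vertexMap := (Equiv.ofBijective φ.vertexMap hv).symm
      edgeMap := (Equiv.ofBijective φ.edgeMap he).symm
      branchMap := (Equiv.ofBijective φ.branchMap hb).symm
      edgeOf_branchMap := fun b' => he.injective (by
        have h1 := (Equiv.ofBijective φ.edgeMap he).apply_symm_apply (G'.edgeOf b')
        have h2 := (Equiv.ofBijective φ.branchMap hb).apply_symm_apply b'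
        rw [Equiv.ofBijective_apply] at h1 h2
        rw [h1, ← φ.edgeOf_branchMap, h2])
      branchMap_injOn := fun _ _ _ h => (Equiv.ofBijective φ.branchMap hb).symm.injective h
      abuts_branchMap := fun b' v' h => by
        have h2 := (Equiv.ofBijective φ.branchMap hb).apply_symm_apply b'
        rw [Equiv.ofBijective_apply] at h2
        rcases hab : G.abuts ((Equiv.ofBijective φ.branchMap hb).symm b') with _ | w
        · have h' := hn _ hab
          rw [h2, h] at h'
          exact absurd h' (Option.some_ne_none v')
        · have h' := φ.abuts_branchMap _ w hab
          rw [h2, h] at h'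
          rw [Option.some.inj h']
          have h3 := (Equiv.ofBijective φ.vertexMap hv).symm_apply_apply w
          rw [Equiv.ofBijective_apply] at h3
          rw [h3] }
  hom_inv_id := SemiGraph.hom_ext _ _
    (funext fun v => (Equiv.ofBijective φ.vertexMap hv).symm_apply_apply v)
    (funext fun e => (Equiv.ofBijective φ.edgeMap he).symm_apply_apply e)
    (funext fun b => (Equiv.ofBijective φ.branchMap hb).symm_apply_apply b)
  inv_hom_id := SemiGraph.hom_ext _ _
    (funext fun v => (Equiv.ofBijective φ.vertexMap hv).apply_symm_apply v)
    (funext fun e => (Equiv.ofBijective φ.edgeMap he).apply_symm_apply e)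
    (funext fun b => (Equiv.ofBijective φ.branchMap hb).apply_symm_apply b)

/-- The morphism is the `hom` of `isoOfBijective`. [cite: MochizukiSemiAnbd2006, §1 p.11] -/
@[simp] theorem Hom.isoOfBijective_hom (φ : G ⟶ G') (hv : Function.Bijective φ.vertexMap)
    (he : Function.Bijective φ.edgeMap) (hb : Function.Bijective φ.branchMap)
    (hn : ∀ b : G.Branch, G.abuts b = none → G'.abuts (φ.branchMap b) = none) :
    (Hom.isoOfBijective φ hv he hb hn).hom = φ := rfl

/-- The map on nodes of barycentric subdivisions induced by a morphism of semi-graphs.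
[cite: MochizukiSemiAnbd2006, §1 pp.11-12] -/
def Hom.nodeMap (φ : G ⟶ G') : G.Node → G'.Node :=
  Sum.map φ.vertexMap (Sum.map φ.edgeMap φ.branchMap)

/-- `nodeMap` of a composite. [cite: MochizukiSemiAnbd2006, §1 p.11] -/
theorem Hom.nodeMap_comp {G'' : SemiGraph.{u}} (φ : G ⟶ G') (ψ : G' ⟶ G'') (x : G.Node) :
    Hom.nodeMap (φ ≫ ψ) x = Hom.nodeMap ψ (Hom.nodeMap φ x) := by
  rcases x with v | e | b <;> rfl

/-- `nodeMap` of the identity. [cite: MochizukiSemiAnbd2006, §1 p.11] -/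
theorem Hom.nodeMap_id (x : G.Node) : Hom.nodeMap (𝟙 G) x = x := by
  rcases x with v | e | b <;> rfl

/-- **An isomorphism of semi-graphs induces an isomorphism of barycentric subdivisions.**
[cite: MochizukiSemiAnbd2006, §1 pp.11-12] -/
def subdivisionIso (e : G ≅ G') : G.subdivision ≃g G'.subdivision where
  toFun := Hom.nodeMap e.hom
  invFun := Hom.nodeMap e.inv
  left_inv x := by rw [← Hom.nodeMap_comp, e.hom_inv_id, Hom.nodeMap_id]
  right_inv x := by rw [← Hom.nodeMap_comp, e.inv_hom_id, Hom.nodeMap_id]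
  map_rel_iff' := by
    intro x y
    constructor
    · intro h
      have h' := subdivision_adj_map e.inv h
      change G.subdivision.Adj (Hom.nodeMap e.inv (Hom.nodeMap e.hom x))
        (Hom.nodeMap e.inv (Hom.nodeMap e.hom y)) at h'
      rwa [← Hom.nodeMap_comp, ← Hom.nodeMap_comp, e.hom_inv_id, Hom.nodeMap_id,
        Hom.nodeMap_id] at h'
    · exact fun h => subdivision_adj_map e.hom h

/-- **Trees transport along isomorphisms of semi-graphs.** [cite: MochizukiSemiAnbd2006, §1 p.13] -/
theorem IsTree.of_iso (e : G ≅ G') (h : G.IsTree) : G'.IsTree :=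
  ⟨(subdivisionIso e).isTree_iff.mp h.isTree⟩

end SemiGraph

end Literature.AnabelianGeometry.SemiGraphs
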